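import Summits.BirchSwinnertonDyer.BirchSwinnertonDyer.Theorems.ResidualThetaTransportAtTwoThetaLayerLambdaCongruenceAtTwoWSideStabilization
import Summits.BirchSwinnertonDyer.BirchSwinnertonDyer.Theorems.ResidualThetaTransportAtTwoThetaLayerLambdaCongruenceAtTwoCurveSymbolPrimitive
import HarnessLib

/-!
# Crux `ThetaLayerLambdaCongruenceAtTwo` (stmt-BirchSwinnertonDyer-20688): the `W`-side layer-`0` element is NON-ZERO on the
# habitat⁺ (`r_an = 0`), hence the `W`-side analytic layer law at `2` holds with NO hypothesis beyond the habitat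

Width seat bsd-wall-rtt-p3-w3 (`--supports stmt-BirchSwinnertonDyer-20688`; closes nothing). THEOREMS ONLY.

* `two_mul_plusSymbolK_one_quarter`: for a newform `g` on `Γ₀(M)`, `2 ∤ M`, `a₂(g) = 0`, plus period `Ω`:
  `2·[1/4]⁺_{g,Ω} = −[0]⁺_{g,Ω}` (Hecke at `2` at `r = 1/2`).
* `mazurTateElementK_two_layer_zero`: `θ_0(g;Ω) = C(2·[1/4]⁺_{g,Ω})`.
* `wSide_layer_zero_ne_zero`: on the habitat⁺ (`GoodSS W 2`, `a₂(W) = 0`, `analyticRank W = 0`), for the newform `f` of `W` and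
  every `S₀` off `2`: `Θ^{S₀}_0(W) = C(2·ι_f[1/4]⁺·∏_v L_v(W,ℓ_v⁻¹)) ≠ 0` — `[0]⁺_f ≠ 0` because `L(W,1) ≠ 0`
  (`analyticRank_eq_zero_iff_holds`, `IsNewformOf.entireLFunction_one_eq`) and `L_v(W,ℓ⁻¹) ≠ 0` (w2's
  `eval_inv_localPolynomialAt_ne_zero`). This is where the habitat's `analyticRank = 0` binder is USED on the analytic side.
* `wSide_growth_habitat`: hence `wSide_eventual_growth` applies with NO non-vanishing hypothesis: on the habitat⁺ there is an
  even layer `n₁` with `Θ^{S₀}_{n₁}(W) ≠ 0` and `3λ(Θ_{n₁+2k}(W)) + 2^{n₁} = 3λ(Θ_{n₁}(W)) + 2^{n₁}·4^k` for all `k`.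

Nothing about any curve or form is asserted beyond these; BSD is not proved by any of this.
-/

noncomputable section

-- justification: the `Summit.BirchSwinnertonDyer.BirchSwinnertonDyer.…` path repeats a component (route-file convention)
set_option linter.dupNamespace false

open scoped Classical

open Polynomial

open Literature.NumberTheory.IwasawaTheory Literature.NumberTheory.EllipticCurves
  Literature.NumberTheory.EllipticCurves.ModularForms

namespace Summit.BirchSwinnertonDyer.BirchSwinnertonDyer.Theorems.ThetaLayerLambdaCongruenceAtTwo

section LayerZero

variable {M : ℕ} [NeZero M] {g : CuspForm (CongruenceSubgroup.Gamma0 M) 2} (Ω : ℂ)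

/-- **`2·[1/4]⁺ = −[0]⁺`** for a newform with `a₂ = 0` on odd level (Hecke at `2` at `r = 1/2`: `[1]⁺ = −([1/4]⁺ + [3/4]⁺)`,
`[1]⁺ = [0]⁺`, `[3/4]⁺ = [1/4]⁺`). [cite: MazurTateTeitelbaum1986Invent, §I.4 (4.2)] -/
theorem two_mul_plusSymbolK_one_quarter (hg : IsNewform0 g) (h2M : ¬ 2 ∣ M) (ha2 : cuspCoeff g 2 = 0)
    (hΩ : IsPlusPeriod g Ω) :
    (2 : coeffField g) * plusSymbolK g Ω (1 / 4) = -plusSymbolK g Ω 0 := by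
  have h := plusSymbolK_two_mul Ω hg h2M ha2 hΩ (1 / 2)
  have e1 : (2 : ℚ) * (1 / 2) = 0 + (1 : ℤ) := by norm_num
  have e2 : (1 / 2 : ℚ) / 2 = 1 / 4 := by norm_num
  have e3 : ((1 / 2 : ℚ) + 1) / 2 = -(1 / 4) + (1 : ℤ) := by norm_num
  rw [e1, e2, e3, plusSymbolK_add_intCast, plusSymbolK_add_intCast, plusSymbolK_neg] at h
  linear_combination h

/-- **`θ_0(g;Ω) = C(2·[1/4]⁺_{g,Ω})`** (the doubled layer-`0` element: one symbol, `5⁰/2² = 1/4`). [cite: MazurTateTeitelbaum1986Invent, §I.13] -/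
theorem mazurTateElementK_two_layer_zero :
    mazurTateElementK g Ω 2 0 = C ((2 : coeffField g) * plusSymbolK g Ω (1 / 4)) := by
  rw [mazurTateElementK_two, halfLayer_eq_sum_range, pow_zero, Finset.sum_range_one, pow_zero, pow_zero, mul_one, map_mul]
  norm_num

end LayerZero

section WSide

variable {W : WeierstrassCurve ℚ} [W.IsElliptic] [W.IsGloballyMinimal] [NeZero (W.conductorNorm ℤ)]
  {f : CuspForm (CongruenceSubgroup.Gamma0 (W.conductorNorm ℤ)) 2}
  (S₀ : Finset (IsDedekindDomain.HeightOneSpectrum (NumberField.RingOfIntegers ℚ)))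

/-- **The `W`-side depleted element at layer `0` is non-zero on the habitat⁺**: for `W` with `GoodSS W 2`, `a₂(W) = 0`,
`analyticRank W = 0`, its newform `f`, and `S₀` off `2`, `Θ^{S₀}_0(W) ≠ 0` — it is the constant
`2·ι_f[1/4]⁺_f·∏_v L_v(W,ℓ_v⁻¹)` with `2[1/4]⁺ = −[0]⁺ ≠ 0` (`L(W,1) ≠ 0`) and every `L_v(W,ℓ_v⁻¹) ≠ 0`.
[cite: MazurTateTeitelbaum1986Invent, §I.8 (8.6) ([0]⁺ = L(f,1)/Ω⁺)] -/
theorem wSide_layer_zero_ne_zero (hss : Literature.NumberTheory.EllipticCurves.Rank1Residual.GoodSS W 2)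
    (ha : W.frobeniusTrace 2 = 0) (hr : W.analyticRank = 0) (hf : IsNewformOf W f)
    (hS2 : ∀ v ∈ S₀, ((2 : ℕ) : NumberField.RingOfIntegers ℚ) ∉ v.asIdeal) :
    (((Literature.NumberTheory.EllipticCurves.mazurTateElement f 2 0).map (algebraMap ℚ (PadicAlgCl 2)) * ∏ v ∈ S₀, ((W.localPolynomialAt v).map (Int.castRingHom (PadicAlgCl 2))).comp (Polynomial.C ((Rat.HeightOneSpectrum.natGenerator v : PadicAlgCl 2)⁻¹) * (Polynomial.X + 1) ^ (PadicInt.toZModPow 0 (-(Literature.NumberTheory.EllipticCurves.GreenbergVatsal2000.frobeniusExponent 2 (Rat.HeightOneSpectrum.natGenerator v : ℤ_[2])))).val)) %ₘ ((Polynomial.X + 1) ^ 2 ^ 0 - 1)) ≠ 0 := by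
  obtain ⟨hf0, h2N, ha2, hQ, hΩf⟩ := wSide_hyps hss ha hf
  obtain ⟨ιf, hι⟩ := exists_emb_map_mazurTateElement_eq hf0 hQ
  -- `[0]⁺_f ≠ 0` from `L(W,1) ≠ 0`
  have hL : W.entireLFunction 1 ≠ 0 := (W.analyticRank_eq_zero_iff_holds hf.hasEntireLFunction).mp hr
  have hsym : ratPlusSymbol f 0 ≠ 0 := fun h ↦ hL (by rw [hf.entireLFunction_one_eq, h]; simp)
  have hK0 : plusSymbolK f (plusPeriod f : ℂ) 0 ≠ 0 := by
    rw [plusSymbolK_plusPeriod_eq_algebraMap hf0 hQ 0]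
    exact (map_ne_zero_iff _ (algebraMap ℚ (coeffField f)).injective).mpr hsym
  have hq : (2 : coeffField f) * plusSymbolK f (plusPeriod f : ℂ) (1 / 4) ≠ 0 := by
    rw [two_mul_plusSymbolK_one_quarter (plusPeriod f : ℂ) hf0 h2N ha2 hΩf]
    exact neg_ne_zero.mpr hK0
  -- the modulus at layer `0` is `X`
  have hω : ((X + 1 : (PadicAlgCl 2)[X]) ^ 2 ^ 0 - 1) = X := by rw [pow_zero, pow_one, add_sub_cancel_right]
  rw [hω, modByMonic_X, Ne, Polynomial.C_eq_zero, eval_mul, hι 0, mazurTateElementK_two_layer_zero, Polynomial.map_C, eval_C,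
    eval_prod]
  refine mul_ne_zero ((map_ne_zero_iff _ ιf.injective).mpr hq) (Finset.prod_ne_zero_iff.mpr fun v hv ↦ ?_)
  rw [eval_comp, eval_mul, eval_C, eval_pow, eval_add, eval_X, eval_one, zero_add, one_pow, mul_one]
  exact eval_inv_localPolynomialAt_ne_zero (W := W) v (not_two_dvd_natGenerator (hS2 v hv))

/-- **THE `W`-SIDE ANALYTIC LAYER LAW AT `2` ON THE HABITAT⁺ — no hypothesis beyond the habitat**: for `W` with `GoodSS W 2`,
`a₂(W) = 0`, `analyticRank W = 0`, its newform `f` and every `S₀` off `2`, there is an even layer `n₁ = 2j₀` with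
`Θ^{S₀}_{n₁}(W) ≠ 0` and `3λ(Θ^{S₀}_{n₁+2k}(W)) + 2^{n₁} = 3λ(Θ^{S₀}_{n₁}(W)) + 2^{n₁}·4^k` for ALL `k`
(`wSide_eventual_growth` with the layer-`0` non-vanishing). [cite: PollackWeston2011MT, Thm. 4.1 (λ(θ_n) = q_n + λ; read at 2, W-side)] -/
theorem wSide_growth_habitat (hss : Literature.NumberTheory.EllipticCurves.Rank1Residual.GoodSS W 2)
    (ha : W.frobeniusTrace 2 = 0) (hr : W.analyticRank = 0) (hf : IsNewformOf W f)
    (hS2 : ∀ v ∈ S₀, ((2 : ℕ) : NumberField.RingOfIntegers ℚ) ∉ v.asIdeal) :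
    ∃ j₀ : ℕ, (((Literature.NumberTheory.EllipticCurves.mazurTateElement f 2 (0 + 2 * j₀)).map (algebraMap ℚ (PadicAlgCl 2)) * ∏ v ∈ S₀, ((W.localPolynomialAt v).map (Int.castRingHom (PadicAlgCl 2))).comp (Polynomial.C ((Rat.HeightOneSpectrum.natGenerator v : PadicAlgCl 2)⁻¹) * (Polynomial.X + 1) ^ (PadicInt.toZModPow (0 + 2 * j₀) (-(Literature.NumberTheory.EllipticCurves.GreenbergVatsal2000.frobeniusExponent 2 (Rat.HeightOneSpectrum.natGenerator v : ℤ_[2])))).val)) %ₘ ((Polynomial.X + 1) ^ 2 ^ (0 + 2 * j₀) - 1)) ≠ 0 ∧ ∀ k : ℕ,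
      3 * layerLambda (((Literature.NumberTheory.EllipticCurves.mazurTateElement f 2 (0 + 2 * j₀ + 2 * k)).map (algebraMap ℚ (PadicAlgCl 2)) * ∏ v ∈ S₀, ((W.localPolynomialAt v).map (Int.castRingHom (PadicAlgCl 2))).comp (Polynomial.C ((Rat.HeightOneSpectrum.natGenerator v : PadicAlgCl 2)⁻¹) * (Polynomial.X + 1) ^ (PadicInt.toZModPow (0 + 2 * j₀ + 2 * k) (-(Literature.NumberTheory.EllipticCurves.GreenbergVatsal2000.frobeniusExponent 2 (Rat.HeightOneSpectrum.natGenerator v : ℤ_[2])))).val)) %ₘ ((Polynomial.X + 1) ^ 2 ^ (0 + 2 * j₀ + 2 * k) - 1)) + 2 ^ (0 + 2 * j₀) = 3 * layerLambda (((Literature.NumberTheory.EllipticCurves.mazurTateElement f 2 (0 + 2 * j₀)).map (algebraMap ℚ (PadicAlgCl 2)) * ∏ v ∈ S₀, ((W.localPolynomialAt v).map (Int.castRingHom (PadicAlgCl 2))).comp (Polynomial.C ((Rat.HeightOneSpectrum.natGenerator v : PadicAlgCl 2)⁻¹) * (Polynomial.X + 1) ^ (PadicInt.toZModPow (0 + 2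 * j₀) (-(Literature.NumberTheory.EllipticCurves.GreenbergVatsal2000.frobeniusExponent 2 (Rat.HeightOneSpectrum.natGenerator v : ℤ_[2])))).val)) %ₘ ((Polynomial.X + 1) ^ 2 ^ (0 + 2 * j₀) - 1)) + 2 ^ (0 + 2 * j₀) * 4 ^ k :=
  wSide_eventual_growth S₀ hss ha hf hS2 0 ⟨0, wSide_layer_zero_ne_zero S₀ hss ha hr hf hS2⟩

end WSide

end Summit.BirchSwinnertonDyer.BirchSwinnertonDyer.Theorems.ThetaLayerLambdaCongruenceAtTwo

end
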